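import Mathlib
import HarnessLib
import Summits.NavierStokesRegularity.NavierStokesRegularity.Theorems.PoloidalWindowDoorPoloidalWindowRigidityEquipartition
import Summits.NavierStokesRegularity.NavierStokesRegularity.Theorems.PoloidalWindowDoorPoloidalWindowRigidityStrainGrowth
import Summits.NavierStokesRegularity.NavierStokesRegularity.Theorems.PoloidalWindowDoorPoloidalWindowRigiditySparseEnergyScaledEnergy

/-!
# Route `PoloidalWindowDoor`, crux `PoloidalWindowRigidity` (stmt-19708), lines `riesz_collapse` (LINE 8) / `sonic_cut` (LINE 9) of ns-idea-8:
# STUB R1 `stub_rieszCollapse` — SEMI-ELLIPTIC SLICES ARE RIGID (price P8-1 of idea-crit-7 g3, 2026-08-28T16:49Z)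

Seat ns-poloidal-K2-p2 g10 (LEAD-lineage on 19708; file `--supports`).  On a slice `s < 0` of a profile of the route's Type-I class,
poloidal along `e₃`, the Riesz mass `e := tr((Dv)²) = Σᵢⱼ ∂ⱼvᵢ∂ᵢvⱼ` reads, by poloidality (`∂₀v₁ = ∂₁v₀`, tree `…StrainGrowth.trace_sq_of_poloidal`),
`e = (∂₀v₀)² + (∂₀v₁)² + (∂₁v₀)² + (∂₁v₁)² + (∂₂v₂)² + 2I`, `I := ∂₂v₀∂₀v₂ + ∂₂v₁∂₁v₂`.  It is a NULL LAGRANGIAN: for a `C²` divergence-free field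
and a `C²` compactly supported weight `φ`, two integrations by parts without boundary (tree `…Equipartition.integral_mul_inner_fderiv_fderiv_eq`,
`Literature…WholeSpaceIBP.integral_inner_convect_add_eq_zero`) give

  `∫ φ · tr((Dv)²) = ∫ ⟪v, D(∇φ) v⟫`                                   (`integral_mul_traceSq_eq_integral_hessian`),

so against the tree cut-off `cutoff R` (`= 1` on `B̄_R`, support `⊆ B̄_{2R}`, `‖D∇ cutoff R‖ ≤ C₂/R²`: `exists_norm_fderiv_gradient_cutoff_le`)
and with S1 (`…ScaledEnergy.scaledEnergy`: `∫_{B_ρ(a)} |v(s)|² ≤ K ρ`) the weighted mass is `O(1/R)`: `|∫ cutoff R · e(s)| ≤ 3 C₂ K / R`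
(`abs_integral_cutoff_mul_traceSq_le_of_class`).  If `I ≥ 0` on the slice then `e ≥ 0`, `∫_{B_r} e ≤ ∫ cutoff R · e → 0`, so `e ≡ 0` and the
three non-negative summands vanish everywhere: `stub_rieszCollapse` — statement VERBATIM from `Cruxes/PoloidalWindowRigidity/Lines/sonic_cut.lean`
(l. 347–366; shared verbatim with `Lines/riesz_collapse.lean`).  (M) is consumed through S1 (the (M)-free semi-elliptic kinematic fields have
`∫_{B_R}|V|² ≍ R³`).

WHAT THIS IS NOT: not a claim about Navier–Stokes regularity; a Liouville-type statement for one cell (`hST`) of hypothetical Type-I profiles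
(bears_on LADDER-NS N0 via crux 19708). [folklore]
-/

noncomputable section

-- the summit and its single sub-problem share the name (CONVENTIONS §1), as in every Theorems file
set_option linter.dupNamespace false

namespace Summit.NavierStokesRegularity.NavierStokesRegularity.Theorems.PoloidalWindowDoorPoloidalWindowRigidityRieszCollapse

open MeasureTheory Set Function Filter Topology Metric InnerProductSpace
open scoped RealInnerProductSpace
open Literature.Analysis Literature.Analysis.FluidPDE
open Summit.NavierStokesRegularity.NavierStokesRegularity.Theorems.PoloidalWindowDoorPoloidalWindowRigidityWindow
open Summit.NavierStokesRegularity.NavierStokesRegularity.Theorems.PoloidalWindowDoorPoloidalWindowRigidityEquipartition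
open Summit.NavierStokesRegularity.NavierStokesRegularity.Theorems.PoloidalWindowDoorPoloidalWindowRigidityStrainGrowth
open Summit.NavierStokesRegularity.NavierStokesRegularity.Theorems.PoloidalWindowDoorPoloidalWindowRigiditySparseEnergyScaledEnergy

/-! ### The Hessian of the tree cut-off is `O(R⁻²)` -/

/-- `∇(cutoff R)(x) = R⁻¹ • ∇(dyadicCutoff)(R⁻¹x)` (chain rule for the dilation). [folklore] -/
theorem gradient_cutoff_eq {R : ℝ} (x : EuclideanSpace ℝ (Fin 3)) :
    gradient (cutoff (E := EuclideanSpace ℝ (Fin 3)) R) x =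
      R⁻¹ • gradient (FunctionSpaces.dyadicCutoff (EuclideanSpace ℝ (Fin 3)) : EuclideanSpace ℝ (Fin 3) → ℝ) (R⁻¹ • x) := by
  have h : fderiv ℝ (cutoff (E := EuclideanSpace ℝ (Fin 3)) R) x =
      R⁻¹ • fderiv ℝ (FunctionSpaces.dyadicCutoff (EuclideanSpace ℝ (Fin 3)) : EuclideanSpace ℝ (Fin 3) → ℝ) (R⁻¹ • x) :=
    fderiv_comp_smul (𝕜 := ℝ) (f := (FunctionSpaces.dyadicCutoff (EuclideanSpace ℝ (Fin 3)) : EuclideanSpace ℝ (Fin 3) → ℝ))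
      (x := x) R⁻¹
  simp only [gradient, h, map_smul]

/-- **`‖D(∇ cutoff R)(x)‖ ≤ C₂/R²`** with one constant `C₂ ≥ 0` for all `R > 0` and all `x`. [folklore] -/
theorem exists_norm_fderiv_gradient_cutoff_le :
    ∃ C₂ : ℝ, 0 ≤ C₂ ∧ ∀ R : ℝ, 0 < R → ∀ x : EuclideanSpace ℝ (Fin 3),
      ‖fderiv ℝ (gradient (cutoff (E := EuclideanSpace ℝ (Fin 3)) R)) x‖ ≤ C₂ / R ^ 2 := by
  set χ : EuclideanSpace ℝ (Fin 3) → ℝ := ⇑(FunctionSpaces.dyadicCutoff (EuclideanSpace ℝ (Fin 3))) with hχ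
  have hχs : ContDiff ℝ 2 χ := (FunctionSpaces.dyadicCutoff (EuclideanSpace ℝ (Fin 3))).contDiff (n := 2)
  have hg1 : ContDiff ℝ 1 (gradient χ) :=
    (InnerProductSpace.toDual ℝ (EuclideanSpace ℝ (Fin 3))).symm.contDiff.comp (hχs.fderiv_right (m := 1) le_rfl)
  have hgc : HasCompactSupport (gradient χ) :=
    ((FunctionSpaces.dyadicCutoff (EuclideanSpace ℝ (Fin 3))).hasCompactSupport.fderiv (𝕜 := ℝ)).comp_left (map_zero _)
  obtain ⟨C, hC⟩ := (hg1.continuous_fderiv one_ne_zero).bounded_above_of_compact_support (hgc.fderiv (𝕜 := ℝ))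
  refine ⟨max C 0, le_max_right _ _, fun R hR x => ?_⟩
  have hfun : gradient (cutoff (E := EuclideanSpace ℝ (Fin 3)) R) = fun y => R⁻¹ • gradient χ (R⁻¹ • y) := by
    funext y; exact gradient_cutoff_eq y
  have h1 : fderiv ℝ (fun y : EuclideanSpace ℝ (Fin 3) => gradient χ (R⁻¹ • y)) x = R⁻¹ • fderiv ℝ (gradient χ) (R⁻¹ • x) :=
    fderiv_comp_smul (𝕜 := ℝ) (f := gradient χ) (x := x) R⁻¹
  have hd : DifferentiableAt ℝ (fun y : EuclideanSpace ℝ (Fin 3) => gradient χ (R⁻¹ • y)) x :=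
    ((hg1.differentiable one_ne_zero) _).comp x ((differentiable_id.const_smul R⁻¹) x)
  have h2 : fderiv ℝ (fun y : EuclideanSpace ℝ (Fin 3) => R⁻¹ • gradient χ (R⁻¹ • y)) x =
      R⁻¹ • fderiv ℝ (fun y : EuclideanSpace ℝ (Fin 3) => gradient χ (R⁻¹ • y)) x :=
    (hd.hasFDerivAt.const_smul R⁻¹).fderiv
  rw [hfun, h2, h1, smul_smul, norm_smul, Real.norm_of_nonneg (by positivity)]
  have hC' : ‖fderiv ℝ (gradient χ) (R⁻¹ • x)‖ ≤ max C 0 := (hC _).trans (le_max_left _ _)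
  have hR2 : 0 < R ^ 2 := by positivity
  rw [le_div_iff₀ hR2]
  calc R⁻¹ * R⁻¹ * ‖fderiv ℝ (gradient χ) (R⁻¹ • x)‖ * R ^ 2 = ‖fderiv ℝ (gradient χ) (R⁻¹ • x)‖ := by
        field_simp
    _ ≤ max C 0 := hC'

/-! ### The integrated null Lagrangian `∫ φ·tr((Dv)²) = ∫ ⟪v, D(∇φ) v⟫` -/

section NullLagrangian

variable {v : EuclideanSpace ℝ (Fin 3) → EuclideanSpace ℝ (Fin 3)} {φ : EuclideanSpace ℝ (Fin 3) → ℝ}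

/-- `Σᵢ ⟪v, eᵢ⟫ • Dφ(Dv eᵢ) = ⟪(v·∇)v, ∇φ⟫` (expand `v` in the standard frame). [folklore] -/
theorem sum_inner_mul_fderiv_apply (x : EuclideanSpace ℝ (Fin 3)) :
    ∑ i : Fin 3, ⟪v x, EuclideanSpace.single i (1 : ℝ)⟫ * fderiv ℝ φ x (fderiv ℝ v x (EuclideanSpace.single i (1 : ℝ))) =
      ⟪convect v v x, gradient φ x⟫ := by
  have hv : ∑ i : Fin 3, ⟪v x, EuclideanSpace.single i (1 : ℝ)⟫ • (EuclideanSpace.single i (1 : ℝ) : EuclideanSpace ℝ (Fin 3)) = v x := by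
    have := (EuclideanSpace.basisFun (Fin 3) ℝ).sum_repr' (v x)
    simp only [EuclideanSpace.basisFun_apply] at this
    calc ∑ i : Fin 3, ⟪v x, EuclideanSpace.single i (1 : ℝ)⟫ • (EuclideanSpace.single i (1 : ℝ) : EuclideanSpace ℝ (Fin 3))
        = ∑ i : Fin 3, ⟪(EuclideanSpace.single i (1 : ℝ) : EuclideanSpace ℝ (Fin 3)), v x⟫ • EuclideanSpace.single i (1 : ℝ) := by
          simp_rw [real_inner_comm]
      _ = v x := this
  calc ∑ i : Fin 3, ⟪v x, EuclideanSpace.single i (1 : ℝ)⟫ * fderiv ℝ φ x (fderiv ℝ v x (EuclideanSpace.single i (1 : ℝ)))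
      = fderiv ℝ φ x (fderiv ℝ v x
          (∑ i : Fin 3, ⟪v x, EuclideanSpace.single i (1 : ℝ)⟫ • (EuclideanSpace.single i (1 : ℝ) : EuclideanSpace ℝ (Fin 3)))) := by
        simp only [map_sum, map_smul, smul_eq_mul]
    _ = ⟪convect v v x, gradient φ x⟫ := by
        rw [hv]
        simp only [convect, gradient]
        rw [real_inner_comm, InnerProductSpace.toDual_symm_apply]

/-- **THE INTEGRATED NULL LAGRANGIAN**: for a `C²` divergence-free field `v` on `ℝ³` and a `C²` compactly supported weight `φ`,
`∫ φ · Σᵢ ⟪eᵢ, Dv(Dv eᵢ)⟫ = ∫ ⟪v, D(∇φ)(v)⟫` — two integrations by parts without boundary (`tr((Dv)²) = ∂ᵢ∂ⱼ(vᵢvⱼ)`). [folklore] -/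
theorem integral_mul_traceSq_eq_integral_hessian (hv : ContDiff ℝ 2 v) (hdiv : VectorCalculus.IsDivFree v)
    (hφ : ContDiff ℝ 2 φ) (hφc : HasCompactSupport φ) :
    ∫ x, φ x * ∑ i : Fin 3, ⟪(EuclideanSpace.single i (1 : ℝ) : EuclideanSpace ℝ (Fin 3)),
        fderiv ℝ v x (fderiv ℝ v x (EuclideanSpace.single i (1 : ℝ)))⟫ =
      ∫ x, ⟪v x, fderiv ℝ (gradient φ) x (v x)⟫ := by
  have hv1 : ContDiff ℝ 1 v := hv.of_le (by norm_num)
  have hφ1 : ContDiff ℝ 1 φ := hφ.of_le (by norm_num)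
  have hDv : Continuous fun x => fderiv ℝ v x := hv.continuous_fderiv (by norm_num)
  have hDφ : Continuous fun x => fderiv ℝ φ x := hφ.continuous_fderiv (by norm_num)
  have hDφc : HasCompactSupport fun x => fderiv ℝ φ x := hφc.fderiv (𝕜 := ℝ)
  -- first integration by parts, entry by entry
  have hterm : ∀ i : Fin 3, Integrable fun x => φ x * ⟪fderiv ℝ v x (fderiv ℝ v x (EuclideanSpace.single i (1 : ℝ))),
      (EuclideanSpace.single i (1 : ℝ) : EuclideanSpace ℝ (Fin 3))⟫ := fun i =>
    (hφ.continuous.mul ((hDv.clm_apply (hDv.clm_apply continuous_const)).inner continuous_const)).integrable_of_hasCompactSupport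
      hφc.mul_right
  have hterm' : ∀ i : Fin 3, Integrable fun x => ⟪v x, EuclideanSpace.single i (1 : ℝ)⟫ *
      fderiv ℝ φ x (fderiv ℝ v x (EuclideanSpace.single i (1 : ℝ))) := fun i => by
    refine ((hv.continuous.inner continuous_const).mul (hDφ.clm_apply (hDv.clm_apply continuous_const))).integrable_of_hasCompactSupport
      (hDφc.mono fun x hx => ?_)
    contrapose! hx
    simp only [mem_support, not_not] at hx
    simp [hx]
  have h1 : ∫ x, φ x * ∑ i : Fin 3, ⟪(EuclideanSpace.single i (1 : ℝ) : EuclideanSpace ℝ (Fin 3)),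
      fderiv ℝ v x (fderiv ℝ v x (EuclideanSpace.single i (1 : ℝ)))⟫ =
      -∫ x, ⟪convect v v x, gradient φ x⟫ := by
    calc ∫ x, φ x * ∑ i : Fin 3, ⟪(EuclideanSpace.single i (1 : ℝ) : EuclideanSpace ℝ (Fin 3)),
          fderiv ℝ v x (fderiv ℝ v x (EuclideanSpace.single i (1 : ℝ)))⟫
        = ∫ x, ∑ i : Fin 3, φ x * ⟪fderiv ℝ v x (fderiv ℝ v x (EuclideanSpace.single i (1 : ℝ))),
            (EuclideanSpace.single i (1 : ℝ) : EuclideanSpace ℝ (Fin 3))⟫ := by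
          refine integral_congr_ae (Eventually.of_forall fun x => ?_)
          simp only [Finset.mul_sum, real_inner_comm]
      _ = ∑ i : Fin 3, ∫ x, φ x * ⟪fderiv ℝ v x (fderiv ℝ v x (EuclideanSpace.single i (1 : ℝ))),
            (EuclideanSpace.single i (1 : ℝ) : EuclideanSpace ℝ (Fin 3))⟫ := integral_finsetSum _ fun i _ => hterm i
      _ = ∑ i : Fin 3, -∫ x, ⟪v x, EuclideanSpace.single i (1 : ℝ)⟫ *
            fderiv ℝ φ x (fderiv ℝ v x (EuclideanSpace.single i (1 : ℝ))) :=
          Finset.sum_congr rfl fun i _ => integral_mul_inner_fderiv_fderiv_eq hv hdiv hφ1 hφc _ _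
      _ = -∫ x, ∑ i : Fin 3, ⟪v x, EuclideanSpace.single i (1 : ℝ)⟫ *
            fderiv ℝ φ x (fderiv ℝ v x (EuclideanSpace.single i (1 : ℝ))) := by
          rw [Finset.sum_neg_distrib, integral_finsetSum _ fun i _ => hterm' i]
      _ = -∫ x, ⟪convect v v x, gradient φ x⟫ := by
          congr 1
          exact integral_congr_ae (Eventually.of_forall fun x => sum_inner_mul_fderiv_apply x)
  -- second integration by parts: `∫ ⟪(v·∇)v, ∇φ⟫ + ∫ ⟪v, (v·∇)∇φ⟫ + ∫ div v ⟪v, ∇φ⟫ = 0`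
  have hg1 : ContDiff ℝ 1 (gradient φ) :=
    (InnerProductSpace.toDual ℝ (EuclideanSpace ℝ (Fin 3))).symm.contDiff.comp (hφ.fderiv_right (m := 1) le_rfl)
  have hgc : HasCompactSupport (gradient φ) := hDφc.comp_left (map_zero _)
  have h2 := integral_inner_convect_add_eq_zero hv1 hv1 hg1 hgc
  have hdiv0 : ∫ x, VectorCalculus.divergence v x * ⟪v x, gradient φ x⟫ = 0 := by
    have hd : ∀ x, VectorCalculus.divergence v x = 0 := hdiv
    simp [hd]
  rw [hdiv0, add_zero] at h2
  rw [h1]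
  simp only [convect] at h2 ⊢
  linarith

end NullLagrangian

/-! ### The class bound: the weighted Riesz mass is `O(1/R)` on every slice -/

variable {C : ℝ} {v : ℝ → EuclideanSpace ℝ (Fin 3) → EuclideanSpace ℝ (Fin 3)}

/-- **`|∫ cutoff R · tr((Dv(s))²)| ≤ 3C₂K/R`** for a profile of the Type-I class (S1 energy bound `K`, cut-off Hessian constant `C₂`),
every slice `s < 0` and every `R > 0`. [folklore] -/
theorem abs_integral_cutoff_mul_traceSq_le_of_class (hrate : HasTypeITimeDecay C v)
    (hcont : ContinuousOn (uncurry v) (Iio (0 : ℝ) ×ˢ univ))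
    (hmild : ∀ s t : ℝ, s < t → t < 0 → ∀ x,
      v t x = UnboundedOperators.heatExtension (v s) (t - s) x - oseenDuhamel 1 s v v t x)
    (hdiv : ∀ t < 0, VectorCalculus.IsDivFree (v t)) :
    ∃ M : ℝ, 0 ≤ M ∧ ∀ s : ℝ, s < 0 → ∀ R : ℝ, 0 < R →
      |∫ x, cutoff (E := EuclideanSpace ℝ (Fin 3)) R x * ∑ i : Fin 3, ⟪(EuclideanSpace.single i (1 : ℝ) : EuclideanSpace ℝ (Fin 3)),
          fderiv ℝ (v s) x (fderiv ℝ (v s) x (EuclideanSpace.single i (1 : ℝ)))⟫| ≤ M / R := by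
  obtain ⟨K, hK0, hK⟩ := scaledEnergy hrate hcont hmild hdiv
  obtain ⟨C₂, hC₂0, hC₂⟩ := exists_norm_fderiv_gradient_cutoff_le
  refine ⟨3 * C₂ * K, by positivity, fun s hs R hR => ?_⟩
  -- the slice is smooth (the class is classical on `(2s, 0) ∋ s`)
  have h2s : 2 * s < 0 := by linarith
  have hv2 : ContDiff ℝ 2 (v s) := by
    obtain ⟨p, hcl⟩ := (isTypeIAncientMild_of_class hrate hcont hmild hdiv).exists_isClassicalNSSolutionOn_Ioo h2s
    exact (hcl.contDiff_velocity ⟨by linarith, hs⟩).of_le (by norm_cast)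
  rw [integral_mul_traceSq_eq_integral_hessian hv2 (hdiv s hs) (contDiff_cutoff (n := 2) R) (hasCompactSupport_cutoff hR)]
  -- the Hessian integrand lives in `B̄(0,2R)` and is bounded by `(C₂/R²)|v|²`
  set B : Set (EuclideanSpace ℝ (Fin 3)) := closedBall (0 : EuclideanSpace ℝ (Fin 3)) (2 * R) with hB
  have hzero : ∀ x ∉ B, ⟪v s x, fderiv ℝ (gradient (cutoff (E := EuclideanSpace ℝ (Fin 3)) R)) x (v s x)⟫ = 0 := by
    intro x hx
    have hx' : x ∉ tsupport (cutoff (E := EuclideanSpace ℝ (Fin 3)) R) := fun h' => hx (FluidPDE.tsupport_cutoff_subset hR h')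
    -- the gradient vanishes on the open set `(tsupport (cutoff R))ᶜ ∋ x`, so its derivative vanishes at `x`
    have hev : gradient (cutoff (E := EuclideanSpace ℝ (Fin 3)) R) =ᶠ[𝓝 x] fun _ => 0 := by
      filter_upwards [(isClosed_tsupport _).isOpen_compl.mem_nhds hx'] with y hy
      simp only [gradient, fderiv_of_notMem_tsupport ℝ hy, map_zero]
    rw [hev.fderiv_eq]
    simp
  rw [← setIntegral_eq_integral_of_forall_compl_eq_zero hzero]
  have hvc : Continuous (v s) := hv2.continuous
  have hint : IntegrableOn (fun x => ‖v s x‖ ^ 2) B := (hvc.norm.pow 2).continuousOn.integrableOn_compact (isCompact_closedBall _ _)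
  -- S1 on the ball `B(0, 3R) ⊇ B̄(0, 2R)`
  have hS1 : ∫ x in B, ‖v s x‖ ^ 2 ≤ K * (3 * R) := by
    have hb := (hK s hs 0 (3 * R) (by positivity)).1
    have hint3 : IntegrableOn (fun x => ‖v s x‖ ^ 2) (ball (0 : EuclideanSpace ℝ (Fin 3)) (3 * R)) :=
      ((hvc.norm.pow 2).continuousOn.integrableOn_compact (isCompact_closedBall 0 (3 * R))).mono_set ball_subset_closedBall
    rw [← ofReal_integral_eq_lintegral_ofReal hint3 (ae_of_all _ fun x => sq_nonneg _)] at hb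
    have h3 := (ENNReal.ofReal_le_ofReal_iff (by positivity)).1 hb
    have hmono : ∫ x in B, ‖v s x‖ ^ 2 ≤ ∫ x in ball (0 : EuclideanSpace ℝ (Fin 3)) (3 * R), ‖v s x‖ ^ 2 :=
      setIntegral_mono_set hint3 (ae_of_all _ fun x => sq_nonneg _)
        (ae_of_all _ (closedBall_subset_ball (by linarith) : B ⊆ ball (0 : EuclideanSpace ℝ (Fin 3)) (3 * R)))
    exact hmono.trans h3
  have hpt : ∀ x ∈ B, ‖⟪v s x, fderiv ℝ (gradient (cutoff (E := EuclideanSpace ℝ (Fin 3)) R)) x (v s x)⟫‖ ≤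
      C₂ / R ^ 2 * ‖v s x‖ ^ 2 := by
    intro x _
    rw [Real.norm_eq_abs]
    calc |⟪v s x, fderiv ℝ (gradient (cutoff (E := EuclideanSpace ℝ (Fin 3)) R)) x (v s x)⟫|
        ≤ ‖v s x‖ * ‖fderiv ℝ (gradient (cutoff (E := EuclideanSpace ℝ (Fin 3)) R)) x (v s x)‖ := abs_real_inner_le_norm _ _
      _ ≤ ‖v s x‖ * (C₂ / R ^ 2 * ‖v s x‖) := by
          gcongr
          exact (ContinuousLinearMap.le_opNorm _ _).trans (mul_le_mul_of_nonneg_right (hC₂ R hR x) (norm_nonneg _))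
      _ = C₂ / R ^ 2 * ‖v s x‖ ^ 2 := by ring
  have hgR1 : ContDiff ℝ 1 (gradient (cutoff (E := EuclideanSpace ℝ (Fin 3)) R)) :=
    (InnerProductSpace.toDual ℝ (EuclideanSpace ℝ (Fin 3))).symm.contDiff.comp
      ((contDiff_cutoff (n := 2) R).fderiv_right (m := 1) le_rfl)
  have hHc : Continuous fun x => fderiv ℝ (gradient (cutoff (E := EuclideanSpace ℝ (Fin 3)) R)) x :=
    hgR1.continuous_fderiv one_ne_zero
  have hIi : IntegrableOn (fun x => ⟪v s x, fderiv ℝ (gradient (cutoff (E := EuclideanSpace ℝ (Fin 3)) R)) x (v s x)⟫) B :=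
    (hvc.inner (hHc.clm_apply hvc)).continuousOn.integrableOn_compact (isCompact_closedBall _ _)
  have hle : |∫ x in B, ⟪v s x, fderiv ℝ (gradient (cutoff (E := EuclideanSpace ℝ (Fin 3)) R)) x (v s x)⟫| ≤
      ∫ x in B, C₂ / R ^ 2 * ‖v s x‖ ^ 2 := by
    rw [← Real.norm_eq_abs]
    exact (norm_integral_le_integral_norm _).trans (setIntegral_mono_on hIi.norm (hint.const_mul _) measurableSet_closedBall hpt)
  calc |∫ x in B, ⟪v s x, fderiv ℝ (gradient (cutoff (E := EuclideanSpace ℝ (Fin 3)) R)) x (v s x)⟫|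
      ≤ ∫ x in B, C₂ / R ^ 2 * ‖v s x‖ ^ 2 := hle
    _ = C₂ / R ^ 2 * ∫ x in B, ‖v s x‖ ^ 2 := integral_const_mul _ _
    _ ≤ C₂ / R ^ 2 * (K * (3 * R)) := by gcongr
    _ = 3 * C₂ * K / R := by
        field_simp

/-! ### R1: semi-elliptic slices are rigid -/

/-- **STUB R1 (`stub_rieszCollapse`) — SEMI-ELLIPTIC SLICES ARE RIGID**, statement VERBATIM from `Cruxes/PoloidalWindowRigidity/Lines/sonic_cut.lean`
(l. 347–366; shared verbatim with LINE 8 `Lines/riesz_collapse.lean`): on a slice `s < 0` of a class profile, poloidal along `e₃`, with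
`I := ∂₂v₀∂₀v₂ + ∂₂v₁∂₁v₂ ≥ 0` everywhere, the three non-negative summands of `tr((Dv)²) = |∇ₕvₕ|²_F + (∂₂v₂)² + 2I` vanish identically.
Proof: `e := tr((Dv(s))²) ≥ 0` pointwise (`trace_sq_of_poloidal`), `∫_{B_r} e ≤ ∫ cutoff R · e ≤ 3C₂K/R` for all `R ≥ r`
(`abs_integral_cutoff_mul_traceSq_le_of_class`), so `∫_{B_r} e = 0`, `e = 0` a.e. and — by continuity — everywhere. [folklore] -/
theorem stub_rieszCollapse :
    ∀ (C : ℝ) (v : ℝ → EuclideanSpace ℝ (Fin 3) → EuclideanSpace ℝ (Fin 3)),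
      Literature.Analysis.FluidPDE.HasTypeITimeDecay C v →
      ContinuousOn (Function.uncurry v) (Set.Iio (0 : ℝ) ×ˢ Set.univ) →
      (∀ s t : ℝ, s < t → t < 0 → ∀ x, v t x =
        Literature.Analysis.UnboundedOperators.heatExtension (v s) (t - s) x -
          Literature.Analysis.FluidPDE.oseenDuhamel 1 s v v t x) →
      (∀ t < 0, Literature.Analysis.FluidPDE.VectorCalculus.IsDivFree (v t)) →
      (∀ s < 0, ∀ y, ⟪Literature.Analysis.FluidPDE.curl (v s) y, EuclideanSpace.single 2 1⟫_ℝ = 0) →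
      ∀ s : ℝ, s < 0 →
        (∀ y : EuclideanSpace ℝ (Fin 3),
          0 ≤ fderiv ℝ (v s) y (EuclideanSpace.single 2 1) 0 * fderiv ℝ (v s) y (EuclideanSpace.single 0 1) 2 +
                fderiv ℝ (v s) y (EuclideanSpace.single 2 1) 1 * fderiv ℝ (v s) y (EuclideanSpace.single 1 1) 2) →
        ∀ y : EuclideanSpace ℝ (Fin 3),
          (fderiv ℝ (v s) y (EuclideanSpace.single 0 1) 0) ^ 2 + (fderiv ℝ (v s) y (EuclideanSpace.single 0 1) 1) ^ 2 +
              (fderiv ℝ (v s) y (EuclideanSpace.single 1 1) 0) ^ 2 + (fderiv ℝ (v s) y (EuclideanSpace.single 1 1) 1) ^ 2 = 0 ∧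
            fderiv ℝ (v s) y (EuclideanSpace.single 2 1) 2 = 0 ∧
            fderiv ℝ (v s) y (EuclideanSpace.single 2 1) 0 * fderiv ℝ (v s) y (EuclideanSpace.single 0 1) 2 +
                fderiv ℝ (v s) y (EuclideanSpace.single 2 1) 1 * fderiv ℝ (v s) y (EuclideanSpace.single 1 1) 2 = 0 := by
  intro C v hrate hcont hmild hdiv hpol s hs hI y
  obtain ⟨M, hM0, hM⟩ := abs_integral_cutoff_mul_traceSq_le_of_class hrate hcont hmild hdiv
  -- the slice is smooth
  have h2s : 2 * s < 0 := by linarith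
  have hv2 : ContDiff ℝ 2 (v s) := by
    obtain ⟨p, hcl⟩ := (isTypeIAncientMild_of_class hrate hcont hmild hdiv).exists_isClassicalNSSolutionOn_Ioo h2s
    exact (hcl.contDiff_velocity ⟨by linarith, hs⟩).of_le (by norm_cast)
  have hDc : Continuous fun x => fderiv ℝ (v s) x := hv2.continuous_fderiv (by norm_num)
  -- the Riesz mass `e = tr((Dv)²)` and its signed expression
  set e : EuclideanSpace ℝ (Fin 3) → ℝ := fun x => ∑ i : Fin 3, ⟪(EuclideanSpace.single i (1 : ℝ) : EuclideanSpace ℝ (Fin 3)),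
      fderiv ℝ (v s) x (fderiv ℝ (v s) x (EuclideanSpace.single i (1 : ℝ)))⟫ with he_def
  have hω : ∀ x, fderiv ℝ (v s) x (EuclideanSpace.single 0 1) 1 = fderiv ℝ (v s) x (EuclideanSpace.single 1 1) 0 := by
    intro x
    have h := hpol s hs x
    rw [EuclideanSpace.inner_single_right, curl_apply_two] at h
    simp only [one_mul, map_sub, RCLike.conj_to_real] at h
    linarith
  have he : ∀ x, e x =
      fderiv ℝ (v s) x (EuclideanSpace.single 0 1) 0 ^ 2 + fderiv ℝ (v s) x (EuclideanSpace.single 0 1) 1 ^ 2 +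
        fderiv ℝ (v s) x (EuclideanSpace.single 1 1) 0 ^ 2 + fderiv ℝ (v s) x (EuclideanSpace.single 1 1) 1 ^ 2 +
        fderiv ℝ (v s) x (EuclideanSpace.single 2 1) 2 ^ 2 +
        2 * (fderiv ℝ (v s) x (EuclideanSpace.single 2 1) 0 * fderiv ℝ (v s) x (EuclideanSpace.single 0 1) 2 +
          fderiv ℝ (v s) x (EuclideanSpace.single 2 1) 1 * fderiv ℝ (v s) x (EuclideanSpace.single 1 1) 2) := fun x =>
    trace_sq_of_poloidal (fderiv ℝ (v s) x) (hω x)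
  have he0 : ∀ x, 0 ≤ e x := fun x => by
    rw [he x]
    nlinarith [hI x, sq_nonneg (fderiv ℝ (v s) x (EuclideanSpace.single 0 1) 0), sq_nonneg (fderiv ℝ (v s) x (EuclideanSpace.single 0 1) 1),
      sq_nonneg (fderiv ℝ (v s) x (EuclideanSpace.single 1 1) 0), sq_nonneg (fderiv ℝ (v s) x (EuclideanSpace.single 1 1) 1),
      sq_nonneg (fderiv ℝ (v s) x (EuclideanSpace.single 2 1) 2)]
  have hec : Continuous e :=
    continuous_finsetSum _ fun i _ => continuous_const.inner (hDc.clm_apply (hDc.clm_apply continuous_const))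
  have hei : ∀ r : ℝ, IntegrableOn e (ball (0 : EuclideanSpace ℝ (Fin 3)) r) := fun r =>
    (hec.continuousOn.integrableOn_compact (isCompact_closedBall 0 r)).mono_set ball_subset_closedBall
  -- every ball integral of `e` vanishes
  have hball : ∀ r : ℝ, 0 < r → ∫ x in ball (0 : EuclideanSpace ℝ (Fin 3)) r, e x = 0 := by
    intro r hr
    have hnn : 0 ≤ ∫ x in ball (0 : EuclideanSpace ℝ (Fin 3)) r, e x := setIntegral_nonneg measurableSet_ball fun x _ => he0 x
    have hup : ∀ R : ℝ, r ≤ R → ∫ x in ball (0 : EuclideanSpace ℝ (Fin 3)) r, e x ≤ M / R := by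
      intro R hrR
      have hR : 0 < R := lt_of_lt_of_le hr hrR
      have hφe : Integrable fun x => cutoff (E := EuclideanSpace ℝ (Fin 3)) R x * e x :=
        ((contDiff_cutoff (n := 0) R).continuous.mul hec).integrable_of_hasCompactSupport (hasCompactSupport_cutoff hR).mul_right
      have h1 : ∫ x in ball (0 : EuclideanSpace ℝ (Fin 3)) r, e x =
          ∫ x in ball (0 : EuclideanSpace ℝ (Fin 3)) r, cutoff (E := EuclideanSpace ℝ (Fin 3)) R x * e x := by
        refine setIntegral_congr_fun measurableSet_ball fun x hx => ?_
        rw [cutoff_eq_one hR ((mem_ball_zero_iff.1 hx).le.trans hrR), one_mul]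
      have h2 : ∫ x in ball (0 : EuclideanSpace ℝ (Fin 3)) r, cutoff (E := EuclideanSpace ℝ (Fin 3)) R x * e x ≤
          ∫ x, cutoff (E := EuclideanSpace ℝ (Fin 3)) R x * e x :=
        setIntegral_le_integral hφe (Eventually.of_forall fun x => mul_nonneg (cutoff_nonneg R x) (he0 x))
      have h3 := hM s hs R hR
      rw [h1]
      exact h2.trans ((le_abs_self _).trans h3)
    refine le_antisymm (le_of_forall_pos_le_add fun ε hε => ?_) hnn
    have hRr : r ≤ max r (M / ε + 1) := le_max_left _ _
    have hRpos : 0 < max r (M / ε + 1) := lt_of_lt_of_le hr hRr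
    have hMR : M / max r (M / ε + 1) ≤ ε := by
      rw [div_le_iff₀ hRpos]
      have h1 : M / ε + 1 ≤ max r (M / ε + 1) := le_max_right _ _
      have h2 : M = ε * (M / ε) := by field_simp
      nlinarith
    linarith [hup _ hRr]
  -- hence `e ≡ 0` (continuity)
  have hez : ∀ x, e x = 0 := by
    intro x
    have hr : 0 < ‖x‖ + 1 := by positivity
    have hae : e =ᵐ[volume.restrict (ball (0 : EuclideanSpace ℝ (Fin 3)) (‖x‖ + 1))] 0 :=
      (setIntegral_eq_zero_iff_of_nonneg_ae (ae_of_all _ fun y => he0 y) (hei _)).1 (hball _ hr)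
    have hEq := Measure.eqOn_open_of_ae_eq hae isOpen_ball hec.continuousOn continuous_zero.continuousOn
    have hx : x ∈ ball (0 : EuclideanSpace ℝ (Fin 3)) (‖x‖ + 1) := mem_ball_zero_iff.2 (by linarith)
    simpa using hEq hx
  -- read off the three summands at `y`
  have hy := hez y
  rw [he y] at hy
  have hIy := hI y
  have h5 : fderiv ℝ (v s) y (EuclideanSpace.single 2 1) 2 ^ 2 = 0 := by
    nlinarith [sq_nonneg (fderiv ℝ (v s) y (EuclideanSpace.single 0 1) 0), sq_nonneg (fderiv ℝ (v s) y (EuclideanSpace.single 0 1) 1),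
      sq_nonneg (fderiv ℝ (v s) y (EuclideanSpace.single 1 1) 0), sq_nonneg (fderiv ℝ (v s) y (EuclideanSpace.single 1 1) 1),
      sq_nonneg (fderiv ℝ (v s) y (EuclideanSpace.single 2 1) 2)]
  refine ⟨?_, pow_eq_zero_iff two_ne_zero |>.1 h5, ?_⟩
  · nlinarith [sq_nonneg (fderiv ℝ (v s) y (EuclideanSpace.single 0 1) 0), sq_nonneg (fderiv ℝ (v s) y (EuclideanSpace.single 0 1) 1),
      sq_nonneg (fderiv ℝ (v s) y (EuclideanSpace.single 1 1) 0), sq_nonneg (fderiv ℝ (v s) y (EuclideanSpace.single 1 1) 1),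
      sq_nonneg (fderiv ℝ (v s) y (EuclideanSpace.single 2 1) 2)]
  · nlinarith [sq_nonneg (fderiv ℝ (v s) y (EuclideanSpace.single 0 1) 0), sq_nonneg (fderiv ℝ (v s) y (EuclideanSpace.single 0 1) 1),
      sq_nonneg (fderiv ℝ (v s) y (EuclideanSpace.single 1 1) 0), sq_nonneg (fderiv ℝ (v s) y (EuclideanSpace.single 1 1) 1),
      sq_nonneg (fderiv ℝ (v s) y (EuclideanSpace.single 2 1) 2)]

end Summit.NavierStokesRegularity.NavierStokesRegularity.Theorems.PoloidalWindowDoorPoloidalWindowRigidityRieszCollapse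

end
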